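import Summits.AtomisticToContinuum.FouriersLaw.Theorems.HonestZwanzigPositiveMemoryUpperLimit
import Summits.AtomisticToContinuum.FouriersLaw.Theorems.HonestZwanzigPositiveMemoryRobinReduction

/-!
# HonestZwanzig / PositiveMemory — the floor from a Green–Kubo floor along a SUBSEQUENCE (line `Sketch`, Stub FQ)

Support file for item `stmt-AtomisticToContinuum-12694` (`PositiveMemory` of route `HonestZwanzig`, sub-problem
`FouriersLaw`), line `Sketch` v8, registered stub `stub_positiveMemory_of_frequentFloor`.

The landed NOT-INSULATING composition (`positiveMemory_of_greenKuboFloor`, `…PositiveMemoryNotInsulating`) asks for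
the Green–Kubo floor `κ(N−1) ≤ ∫₀^∞corr_N(J,J)` for ALL large `N` (`liminf_N D_N > 0`, the sibling crux
`JunctionLocality.ConductanceLowerBound`). Because the Ohm constant `k` of `OrthogonalOhm` does not depend on `N`, the
floor is only needed along ONE SUBSEQUENCE of lengths (`limsup_N D_N > 0`, "the chain is not a perfect insulator at
infinitely many lengths"): along the favourable lengths `Σ_b ρ_b ≥ ∫₀^∞corr(J,J) ≥ κ(N−1)` (`stub_upperLimit`,
landed) forces `k ≥ κ` (`ohm_floor_frequently`), and then the bulk homogeneity of `OrthogonalOhm` transports the floor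
to EVERY length: bulk limits are `≥ k − κ/2 ≥ κ/2`. (Idea card `Cruxes/PositiveMemory/Ideas/flat-dc-covariance-
subsequence-floor.md`, transfer target `GreenKuboNotInsulating`; here typed over the canonical objects and proved.)

* `ohm_floor_frequently` — the `N → ∞` Ohm bookkeeping with the floor assumed only frequently;
* `positiveMemory_of_frequentGreenKuboFloor` — `FeshbachIdentities → OrthogonalOhm → (frequent GK floor) → PositiveMemory`;
* `stub_positiveMemory_of_frequentFloor` — the registered stub (verbatim signature).

No definitions, no named facts, no sorry.
-/

noncomputable section

open MeasureTheory Finset Real Set Filter Topology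
open Literature.MathematicalPhysics.KineticTheory.HeatConduction
open Summit.AtomisticToContinuum.FouriersLaw.Theorems.HonestZwanzig.NetworkReduction

namespace Summit.AtomisticToContinuum.FouriersLaw.Theorems.HonestZwanzig.PositiveMemory

/-- **Ohm bookkeeping along a subsequence.** If the responses `ρ_N` satisfy `|ρ_N(b) − k| ≤ C + |k|` on every
bond and, for every `ε > 0`, `|ρ_N(b) − k| ≤ ε` on the bonds at distance `≥ R(ε)` from both ends (all `N ≥ N₁`),
while `Σ_b ρ_N(b) ≥ κN − C_A` for INFINITELY MANY `N`, then `κ ≤ k`. -/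
theorem ohm_floor_frequently {k C κ CA : ℝ} {N₁ : ℕ} (ρ : (N : ℕ) → Fin N → ℝ) (hC : 0 ≤ C)
    (hall : ∀ N : ℕ, N₁ ≤ N → ∀ b : Fin N, |ρ N b - k| ≤ C + |k|)
    (hbulk : ∀ ε : ℝ, 0 < ε → ∃ R : ℕ, ∀ N : ℕ, N₁ ≤ N → ∀ b : Fin N,
      R ≤ b.val → b.val + 2 + R ≤ N → |ρ N b - k| ≤ ε)
    (hfloor : ∀ N₀ : ℕ, ∃ N : ℕ, N₀ ≤ N ∧ N₁ ≤ N ∧ κ * N - CA ≤ ∑ b, ρ N b) : κ ≤ k := by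
  by_contra hlt
  push Not at hlt
  set ε : ℝ := (κ - k) / 2 with hε
  have hεpos : 0 < ε := by rw [hε]; linarith
  obtain ⟨R, hR⟩ := hbulk ε hεpos
  set K : ℝ := (2 * R + 1) * (C + |k|) with hK
  obtain ⟨N₀, hN₀⟩ := exists_nat_gt ((CA + K) / ε)
  obtain ⟨N, hNN₀, hN₁, hfl⟩ := hfloor N₀
  have hNε : (CA + K) / ε < N := hN₀.trans_le (by exact_mod_cast hNN₀)
  -- upper bound on the sum of responses
  have hsum : ∑ b, ρ N b ≤ N * k + (N * ε + (2 * R + 1) * (C + |k|)) := by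
    have h1 : ∑ b, ρ N b ≤ ∑ b : Fin N, (k + |ρ N b - k|) :=
      Finset.sum_le_sum fun b _ => by linarith [le_abs_self (ρ N b - k)]
    have h2 : ∑ b : Fin N, (k + |ρ N b - k|) = N * k + ∑ b : Fin N, |ρ N b - k| := by
      rw [Finset.sum_add_distrib, Finset.sum_const, Finset.card_univ, Fintype.card_fin, nsmul_eq_mul]
    have h3 := sum_abs_le_of_bulk R (fun b : Fin N => ρ N b - k) hεpos.le (by positivity)
      (fun b h1 h2 => hR N hN₁ b h1 h2) (fun b => hall N hN₁ b)
    linarith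
  -- `N ε ≤ C_A + K`, contradiction
  have h4 : (N : ℝ) * ε ≤ CA + K := by
    have : κ - k - ε = ε := by rw [hε]; ring
    nlinarith
  rw [div_lt_iff₀ hεpos] at hNε
  linarith

/-- **A Green–Kubo floor along a subsequence ⇒ `PositiveMemory`, given `FeshbachIdentities` and `OrthogonalOhm`.**
If for some `κ > 0` the equilibrium total-current autocorrelation integral of the open chain satisfies
`κ(N − 1) ≤ ∫₀^∞corr_N(J,J)` for INFINITELY MANY `N` (`limsup_N D_N > 0` by the Kundu–Dhar–Narayan identity: the
chain is not a perfect insulator along one subsequence of lengths), then the orthogonal-dynamics DC responses of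
`OrthogonalOhm` have the `N`-uniform floor `κ/2` on the bulk bonds at EVERY length: `Σ_b ρ_b ≥ ∫₀^∞corr(J,J)`
(`stub_upperLimit`) along the subsequence forces `k ≥ κ` (`ohm_floor_frequently`, the Ohm constant does not depend
on `N`), and bulk limits are `≥ k − κ/2`. [cite: KunduDharNarayan2009, p. 3] -/
theorem positiveMemory_of_frequentGreenKuboFloor
    (hFI : Summit.AtomisticToContinuum.FouriersLaw.Theses.HonestZwanzig.FeshbachIdentities)
    (hOO : Summit.AtomisticToContinuum.FouriersLaw.Theses.HonestZwanzig.OrthogonalOhm)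
    (hGKF : ∀ ω₂ lam β γ : ℝ, 0 < ω₂ → 0 < lam → 0 < β → 0 < γ → ∀ T : ℝ, 0 < T →
      ∃ κ : ℝ, 0 < κ ∧ ∀ N₀ : ℕ, ∃ N : ℕ, N₀ ≤ N ∧ 2 ≤ N ∧
        κ * ((N : ℝ) - 1) ≤ ∫ t in Set.Ioi (0 : ℝ),
          ((∫ z, (∑ i : Fin N, (pinnedChain ω₂ lam β γ).bondCurrent N i z) *
              (∫ y, (∑ i : Fin N, (pinnedChain ω₂ lam β γ).bondCurrent N i y)
                ∂((pinnedChain ω₂ lam β γ).transitionKernel N T T t.toNNReal z))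
              ∂((pinnedChain ω₂ lam β γ).gibbsMeasure N T)) -
            (∫ z, (∑ i : Fin N, (pinnedChain ω₂ lam β γ).bondCurrent N i z)
              ∂((pinnedChain ω₂ lam β γ).gibbsMeasure N T)) *
            (∫ z, (∑ i : Fin N, (pinnedChain ω₂ lam β γ).bondCurrent N i z)
              ∂((pinnedChain ω₂ lam β γ).gibbsMeasure N T)))) :
    Summit.AtomisticToContinuum.FouriersLaw.Theses.HonestZwanzig.PositiveMemory := by
  intro ω₂ lam β γ hω hl hβ hγ T hT
  obtain ⟨k, C, hkC⟩ := hOO ω₂ lam β γ hω hl hβ hγ T hT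
  obtain ⟨κ, hκ0, hGK⟩ := hGKF ω₂ lam β γ hω hl hβ hγ T hT
  -- the orthogonal-dynamics DC responses, chosen once (`ε = 1`)
  obtain ⟨R₁, hR₁⟩ := hkC 1 one_pos
  have hb1 := fun (N : ℕ) (hN : 2 ≤ N) => (hR₁ N hN).1
  choose ρf hρf using hb1
  have hC0 : 0 ≤ C := (abs_nonneg _).trans (hρf 2 le_rfl ⟨0, by norm_num⟩ (by norm_num)).2.1
  set ρ : (N : ℕ) → Fin N → ℝ := fun N b => if h : 2 ≤ N ∧ b.val + 1 < N then ρf N h.1 b h.2 else 0 with hρ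
  have hρt : ∀ (N : ℕ) (hN : 2 ≤ N) (b : Fin N) (hb : b.val + 1 < N), ρ N b = ρf N hN b hb := by
    intro N hN b hb
    simp only [hρ, dif_pos (And.intro hN hb)]
  have hρ0 : ∀ (N : ℕ) (b : Fin N), ¬ b.val + 1 < N → ρ N b = 0 := by
    intro N b hb
    simp only [hρ]
    rw [dif_neg]
    exact fun h => hb h.2
  -- Step A: `Σ_b ρ_b ≥ ∫₀^∞corr(J,J) ≥ κ(N − 1)` for infinitely many `N ≥ 2`
  have hfloor : ∀ N₀ : ℕ, ∃ N : ℕ, N₀ ≤ N ∧ 2 ≤ N ∧ κ * N - κ ≤ ∑ b, ρ N b := by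
    intro N₀
    obtain ⟨N, hN₀, hN, hgk⟩ := hGK N₀
    refine ⟨N, hN₀, hN, ?_⟩
    have hup := stub_upperLimit hFI ω₂ lam β γ hω hl hβ hγ T hT N hN (ρ N)
      (fun b hb => by rw [hρt N hN b hb]; exact (hρf N hN b hb).1) (fun b hb => hρ0 N b hb)
    dsimp only at hup
    have hκN : κ * N - κ = κ * ((N : ℝ) - 1) := by ring
    rw [hκN]
    exact hgk.trans hup
  -- Step B: the Ohm constant is at least `κ`
  have hall : ∀ N : ℕ, 2 ≤ N → ∀ b : Fin N, |ρ N b - k| ≤ C + |k| := by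
    intro N hN2 b
    by_cases hb : b.val + 1 < N
    · rw [hρt N hN2 b hb]
      have h := (hρf N hN2 b hb).2.1
      calc |ρf N hN2 b hb - k| ≤ |ρf N hN2 b hb| + |k| := abs_sub _ _
        _ ≤ C + |k| := by linarith
    · rw [hρ0 N b hb, zero_sub, abs_neg]
      linarith [abs_nonneg k]
  have hbulk : ∀ ε : ℝ, 0 < ε → ∃ R : ℕ, ∀ N : ℕ, 2 ≤ N → ∀ b : Fin N,
      R ≤ b.val → b.val + 2 + R ≤ N → |ρ N b - k| ≤ ε := by
    intro ε hε
    obtain ⟨R, hR⟩ := hkC ε hε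
    refine ⟨R, fun N hN2 b h1 h2 => ?_⟩
    have hb : b.val + 1 < N := by omega
    obtain ⟨hbonds, -⟩ := hR N hN2
    obtain ⟨ρ', hρ', -, hρ'k⟩ := hbonds b hb
    have heq : ρf N hN2 b hb = ρ' := tendsto_nhds_unique (hρf N hN2 b hb).1 hρ'
    rw [hρt N hN2 b hb, heq]
    exact hρ'k h1 h2
  have hk : κ ≤ k := ohm_floor_frequently (N₁ := 2) ρ hC0 hall hbulk
    (fun N₀ => by
      obtain ⟨N, hN₀, hN, h⟩ := hfloor N₀
      exact ⟨N, hN₀, hN, h⟩)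
  -- Step C: every bulk limit is the Ohm response, hence `≥ k − κ/2 ≥ κ/2`
  refine ⟨κ / 2, by positivity, ?_⟩
  obtain ⟨R, hR⟩ := hkC (κ / 2) (by positivity)
  refine ⟨R, fun N hN => ?_⟩
  intro P X μ corr lap e G schur J b hRb hbN ρ₀ hρ₀
  have hb : b.val + 1 < N := by omega
  obtain ⟨hbonds, -⟩ := hR N hN
  obtain ⟨ρ', hρ', -, hρ'k⟩ := hbonds b hb
  have heq : ρ₀ = ρ' := tendsto_nhds_unique hρ₀ hρ'
  have h1 := hρ'k hRb hbN
  rw [abs_le] at h1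
  rw [heq]
  linarith

/-- **Stub FQ — a Green–Kubo floor along a SUBSEQUENCE suffices** (registered v8; bookkeeping, provable now):
`FeshbachIdentities → OrthogonalOhm → (∃ κ > 0 with κ(N−1) ≤ ∫₀^∞corr_N(J,J) for infinitely many N ≥ 2) →
PositiveMemory`. Given crux #2, crux #3 needs the conjunct's "not a perfect insulator" only along one subsequence of
lengths (`limsup_N D_N > 0`), strictly less than `JunctionLocality.ConductanceLowerBound` (`liminf`).
[cite: KunduDharNarayan2009, p. 3] -/
theorem stub_positiveMemory_of_frequentFloor :
    Summit.AtomisticToContinuum.FouriersLaw.Theses.HonestZwanzig.FeshbachIdentities →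
    Summit.AtomisticToContinuum.FouriersLaw.Theses.HonestZwanzig.OrthogonalOhm →
    (∀ ω₂ lam β γ : ℝ, 0 < ω₂ → 0 < lam → 0 < β → 0 < γ → ∀ T : ℝ, 0 < T →
      ∃ κ : ℝ, 0 < κ ∧ ∀ N₀ : ℕ, ∃ N : ℕ, N₀ ≤ N ∧ 2 ≤ N ∧
      let P := Literature.MathematicalPhysics.KineticTheory.HeatConduction.pinnedChain ω₂ lam β γ;
      let X := Literature.MathematicalPhysics.KineticTheory.HeatConduction.PhaseSpace N;
      let μ : MeasureTheory.Measure X := P.gibbsMeasure N T;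
      let J : X → ℝ := fun z => ∑ i : Fin N, P.bondCurrent N i z;
      κ * ((N : ℝ) - 1) ≤ ∫ t in Set.Ioi (0 : ℝ),
        ((∫ z, J z * (∫ y, J y ∂(P.transitionKernel N T T t.toNNReal z)) ∂μ) - (∫ z, J z ∂μ) * (∫ z, J z ∂μ))) →
    Summit.AtomisticToContinuum.FouriersLaw.Theses.HonestZwanzig.PositiveMemory := by
  intro hFI hOO hGKF
  exact positiveMemory_of_frequentGreenKuboFloor hFI hOO hGKF

end Summit.AtomisticToContinuum.FouriersLaw.Theorems.HonestZwanzig.PositiveMemory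

end
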